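import Summits.AtomisticToContinuum.Crystallization.Theorems.BrittleRungDescentMieRungCensus

/-!
# Route `BrittleRungDescent`, item `MieRung` (stmt-AtomisticToContinuum-10946), X: the
# coordination census with an explicit defect density

Part IX (`…MieRungCensus`) states the census qualitatively (`∀ δ > 0, ∃ q₀(η, δ), …`).  The same
energy sandwich gives an EXPLICIT, exponentially small defect density with a threshold `q₀` that
does not depend on the tolerance or on the density:

* `eventually_card_near_ne_twelve_le_explicit` — there are `η₀ > 0` and `q₀` such that for every
  `q ≥ q₀`, every `η ∈ (0, η₀]` and every `δ > 32000 · (1 + η)^{-(q−6)}`, along every sequence of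
  ground states of `V_q = miePotential q` in `ℝ³`, eventually in `N` at most `δ N` particles have
  soft coordination number `#{j ≠ i : |xᵢ − xⱼ| ≤ 1 + η} ≠ 12`.  In words: the density of
  under-coordinated particles in large Mie ground states is at most `32000 (1 + η)^{6−q}` — the
  quantitative form of the "defect density `O(θ^p)`" foreseen for the bond-counting layer of the
  crux `MieSoftKissing` (stmt-AtomisticToContinuum-10943), with the shell cut at `1 + η` instead of
  Hales's gap radius `1.26`.

(`32000 = 2q · 250 · 2⁶ / q`: the shell-sum constant `250` of `sum_inv_pow_six_le` at separation
`1 − 2/q ≥ 1/2`.)  `[folklore]` given parts VII–IX.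
-/

noncomputable section

open scoped BigOperators Topology
open Filter Set Metric

namespace Summit.AtomisticToContinuum.Crystallization.Theorems.MieRungCoordination

open Literature.MathematicalPhysics.StatisticalMechanics
open Summit.AtomisticToContinuum.Crystallization.Theorems.MieRungEnergetic

/-- **The census with an explicit density.** There are `η₀ > 0` and `q₀` such that for all
`q ≥ q₀`, `η ∈ (0, η₀]` and `δ > 32000 (1 + η)^{-(q−6)}`: along every sequence of ground states
of `V_q`, eventually in `N` at most `δ N` particles `i` have `#{j ≠ i : |xᵢ − xⱼ| ≤ 1 + η} ≠ 12`.
Proof: with `D = 32000 (1+η)^{-(q−6)} ≥ 2q · N⁻¹ ·` (tail term) and `ε = (δ − D)/(4q)` in the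
upper bound `E(N)/N ≤ −3/q + ε`, the sandwich gives `Σ_i (12 − n_i) ≤ 4qεN + DN = δN`.
[folklore] -/
theorem eventually_card_near_ne_twelve_le_explicit :
    ∃ η₀ : ℝ, 0 < η₀ ∧ ∃ q₀ : ℕ, ∀ q : ℕ, q₀ ≤ q → ∀ η : ℝ, 0 < η → η ≤ η₀ → ∀ δ : ℝ,
      32000 * (1 + η)⁻¹ ^ (q - 6) < δ →
        ∀ x : (N : ℕ) → (Fin N → EuclideanSpace ℝ (Fin 3)),
          (∀ N, IsGroundState (miePotential q) (x N)) →
            ∀ᶠ N : ℕ in atTop,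
              (Nat.card {i : Fin N //
                  Nat.card {j : Fin N // j ≠ i ∧ dist (x N i) (x N j) ≤ 1 + η} ≠ 12} : ℝ) ≤
                δ * N := by
  classical
  obtain ⟨ε₁₂, hε₁₂, -, hcap⟩ := exists_soft_cap
  obtain ⟨q₁, hq₁⟩ := exists_nat_ge (2 / ε₁₂)
  refine ⟨ε₁₂, hε₁₂, max 500 q₁, fun q hq η hη hηε δ hδ x hx => ?_⟩
  have hq500 : 500 ≤ q := le_trans (le_max_left _ _) hq
  have hqq₁ : q₁ ≤ q := le_trans (le_max_right _ _) hq
  have hq6 : 6 ≤ q := by omega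
  have hqpos : (0 : ℝ) < q := by exact_mod_cast (show 0 < q by omega)
  have hq500r : (500 : ℝ) ≤ q := by exact_mod_cast hq500
  -- the separation radius `r = 1 − 2/q`
  set r : ℝ := 1 - 2 / (q : ℝ) with hr_def
  have h2q : 2 / (q : ℝ) ≤ ε₁₂ := by
    have : (2 : ℝ) / ε₁₂ ≤ q := hq₁.trans (by exact_mod_cast hqq₁)
    rw [div_le_iff₀ hε₁₂] at this
    rw [div_le_iff₀ hqpos]
    linarith
  have h2q' : 2 / (q : ℝ) ≤ 1 / 2 := by
    rw [div_le_iff₀ hqpos]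
    linarith
  have hr_half : (1 : ℝ) / 2 ≤ r := by rw [hr_def]; linarith
  have hr0 : 0 < r := by linarith
  have hrε : 1 - ε₁₂ ≤ r := by rw [hr_def]; linarith
  have hr6 : r⁻¹ ^ 6 ≤ 64 := by
    have h2 : r⁻¹ ≤ 2 :=
      calc r⁻¹ ≤ (1 / 2 : ℝ)⁻¹ := inv_anti₀ (by norm_num) hr_half
        _ = 2 := by norm_num
    calc r⁻¹ ^ 6 ≤ (2 : ℝ) ^ 6 := pow_le_pow_left₀ (inv_nonneg.2 hr0.le) h2 6
      _ = 64 := by norm_num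
  -- the tail constant `2q·T ≤ D := 32000 c^(q-6)`
  have hc0 : 0 ≤ (1 + η)⁻¹ := inv_nonneg.2 (by linarith)
  set D : ℝ := 32000 * (1 + η)⁻¹ ^ (q - 6) with hD_def
  have htail : 2 * (q : ℝ) * (250 * r⁻¹ ^ 6 / (q : ℝ) * (1 + η)⁻¹ ^ (q - 6)) ≤ D := by
    have hcq : 0 ≤ (1 + η)⁻¹ ^ (q - 6) := pow_nonneg hc0 _
    have h1 : 2 * (q : ℝ) * (250 * r⁻¹ ^ 6 / (q : ℝ) * (1 + η)⁻¹ ^ (q - 6)) =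
        500 * r⁻¹ ^ 6 * (1 + η)⁻¹ ^ (q - 6) := by
      field_simp
      ring
    rw [h1, hD_def]
    calc 500 * r⁻¹ ^ 6 * (1 + η)⁻¹ ^ (q - 6) ≤ 500 * 64 * (1 + η)⁻¹ ^ (q - 6) :=
          mul_le_mul_of_nonneg_right (by linarith) hcq
      _ = 32000 * (1 + η)⁻¹ ^ (q - 6) := by norm_num
  -- the energy upper bound with `ε = (δ − D)/(4q)`
  have hεq : 0 < (δ - D) / (4 * (q : ℝ)) := by
    have : 0 < δ - D := by rw [hD_def]; linarith
    positivity
  filter_upwards [eventually_groundStateEnergy_div_le_ladder hq6 hεq, eventually_gt_atTop 0]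
    with N hEN hN0
  have hy := hx N
  have hNpos : (0 : ℝ) < N := by exact_mod_cast hN0
  have hsep : ∀ k l : Fin N, k ≠ l → r ≤ dist (x N k) (x N l) := fun k l hkl =>
    LadderGroundStates.le_dist_of_isGroundState_miePotential hq500 hy hkl
  have hcap' : ∀ i : Fin N,
      Nat.card {j : Fin N // j ≠ i ∧ dist (x N i) (x N j) ≤ 1 + η} ≤ 12 := fun i =>
    (natCard_near_mono (x N) hηε i).trans (hcap (x N) (fun k l hkl => hrε.trans (hsep k l hkl)) i)
  have hlow := two_mul_interactionEnergy_ge_sum_nearCount hq6 hr0 hsep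
    (show 0 < 1 + η by linarith) (x := x N)
  have hup : interactionEnergy (miePotential q) (x N) ≤
      (N : ℝ) * (-(3 / (q : ℝ)) + (δ - D) / (4 * (q : ℝ))) := by
    rw [hy.2]
    rw [div_le_iff₀ hNpos] at hEN
    linarith
  set T : ℝ := 250 * r⁻¹ ^ 6 / (q : ℝ) * (1 + η)⁻¹ ^ (q - 6) with hT_def
  set S : ℝ := ∑ i : Fin N, (Nat.card {j : Fin N // j ≠ i ∧ dist (x N i) (x N j) ≤ 1 + η} : ℝ)
    with hS_def
  have hsum : 12 * (N : ℝ) - δ * N ≤ S := by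
    have h1 : -(S / (2 * (q : ℝ))) - (N : ℝ) * T ≤
        2 * ((N : ℝ) * (-(3 / (q : ℝ)) + (δ - D) / (4 * (q : ℝ)))) := hlow.trans (by linarith)
    have h2 := mul_le_mul_of_nonneg_left h1 (show (0 : ℝ) ≤ 2 * q by positivity)
    have e1 : 2 * (q : ℝ) * (-(S / (2 * (q : ℝ))) - (N : ℝ) * T) =
        -S - (N : ℝ) * (2 * (q : ℝ) * T) := by
      field_simp
    have e2 : 2 * (q : ℝ) * (2 * ((N : ℝ) * (-(3 / (q : ℝ)) + (δ - D) / (4 * (q : ℝ))))) =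
        -(12 * (N : ℝ)) + (δ - D) * N := by
      field_simp
      ring
    rw [e1, e2] at h2
    have h3 : (N : ℝ) * (2 * (q : ℝ) * T) ≤ (N : ℝ) * D :=
      mul_le_mul_of_nonneg_left htail hNpos.le
    linarith
  have hcount := card_ne_twelve_le hcap' (B := δ * N) (by rw [hS_def] at hsum; linarith)
  have hconv : (Nat.card {i : Fin N //
      Nat.card {j : Fin N // j ≠ i ∧ dist (x N i) (x N j) ≤ 1 + η} ≠ 12} : ℝ) =
      ((Finset.univ.filter fun i : Fin N =>
        Nat.card {j : Fin N // j ≠ i ∧ dist (x N i) (x N j) ≤ 1 + η} ≠ 12).card : ℝ) := by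
    rw [Nat.card_eq_fintype_card, Fintype.card_subtype]
  rw [hconv]
  convert hcount using 3

/-- **Explicit density, `MieSoftKissing` vocabulary** (defect predicate without the annulus
clause): with `η₀`, `q₀` as above, for `q ≥ q₀` with `2/q ≤ η`, `η ∈ (0, η₀]` and
`δ > 32000 (1 + η)^{-(q−6)}`, eventually at most `δ N` particles of a ground state of `V_q` fail
to be [at distance `≥ 1 − η` from all others, with exactly twelve others within `1 + η`].
[folklore] -/
theorem eventually_card_not_kissed_le_explicit :
    ∃ η₀ : ℝ, 0 < η₀ ∧ ∃ q₀ : ℕ, ∀ q : ℕ, q₀ ≤ q → ∀ η : ℝ, 0 < η → η ≤ η₀ → 2 / (q : ℝ) ≤ η →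
      ∀ δ : ℝ, 32000 * (1 + η)⁻¹ ^ (q - 6) < δ →
        ∀ x : (N : ℕ) → (Fin N → EuclideanSpace ℝ (Fin 3)),
          (∀ N, IsGroundState (miePotential q) (x N)) →
            ∀ᶠ N : ℕ in atTop,
              (Nat.card {i : Fin N // ¬ ((∀ j : Fin N, j ≠ i → 1 - η ≤ dist (x N i) (x N j)) ∧
                  Nat.card {j : Fin N // j ≠ i ∧ dist (x N i) (x N j) ≤ 1 + η} = 12)} : ℝ) ≤
                δ * N := by
  obtain ⟨η₀, hη₀, q₀, hq₀⟩ := eventually_card_near_ne_twelve_le_explicit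
  refine ⟨η₀, hη₀, max q₀ 500, fun q hq η hη hηη₀ h2q δ hδ x hx => ?_⟩
  have hqq₀ : q₀ ≤ q := le_trans (le_max_left _ _) hq
  have hq500 : 500 ≤ q := le_trans (le_max_right _ _) hq
  filter_upwards [hq₀ q hqq₀ η hη hηη₀ δ hδ x hx] with N hN
  have hsep : ∀ i j : Fin N, j ≠ i → 1 - η ≤ dist (x N i) (x N j) := fun i j hji => by
    have := LadderGroundStates.le_dist_of_isGroundState_miePotential hq500 (hx N) hji.symm
    linarith
  have hcard : Nat.card {i : Fin N // ¬ ((∀ j : Fin N, j ≠ i → 1 - η ≤ dist (x N i) (x N j)) ∧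
      Nat.card {j : Fin N // j ≠ i ∧ dist (x N i) (x N j) ≤ 1 + η} = 12)} =
      Nat.card {i : Fin N //
        Nat.card {j : Fin N // j ≠ i ∧ dist (x N i) (x N j) ≤ 1 + η} ≠ 12} :=
    Nat.card_congr (Equiv.subtypeEquivRight fun i =>
      ⟨fun h h12 => h ⟨hsep i, h12⟩, fun h h' => h h'.2⟩)
  rw [hcard]
  exact hN

end Summit.AtomisticToContinuum.Crystallization.Theorems.MieRungCoordination

end
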